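import Mathlib
import Summits.CriticalPhenomena.SAWScalingLimit.Theorems.SAWDefectDecoherenceObservableToSLERNestedTransferR4

/-!
# THE NESTED TRANSFER UNDER AN ARBITRARY FAMILY CONSTRAINT (stub `stub_nestedTransferP`, reshape r6
# of the line `bridge-gate-renewal`)

Support file for the registered stub `stub_nestedTransferP` (stub 6 of reshape r6) of the line
`bridge-gate-renewal` for the crux
`Summit.CriticalPhenomena.SAWScalingLimit.Theses.SAWDefectDecoherence.ObservableToSLER`
(item `stmt-CriticalPhenomena-14005`):
`∀ P, GateDecomposition → NestedRenewalP P → CarvedToSLENP P → FullIdentification`.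

Reshape r6 (lead `prover-line-stmt-CriticalPhenomena-14005-c2-0`) threads an ARBITRARY constraint
`P D a b δ ρ R N S T` on the pair of gate families from the abundance input (the produced tame nested
families satisfy `P`) to the identification input (which assumes `P`); the r4 stub
(`R4.stub_nestedTransfer`, `Theorems/SAWDefectDecoherenceObservableToSLERNestedTransferR4.lean`,
p112206) is the instance `P :=` "both families exterior-anchored", and the r6 composition uses
`P := AnchoredClassZero` (anchored, class-zero windows).  The proof is the r4 proof verbatim with the
two anchoring facts replaced by the one opaque fact `hP`: `R₀` from the identification input, `R₁`
from the eventual product structure of the cells (`eventually_productCellN`, ALL tame nested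
families), `R` small, `(ρ, N)` and at each small mesh the `P`-families `S, T` from the abundance
input, the per-mesh estimate `abs_integral_sub_le_of_productCellN_link` (landed, r4), limit along the
subsequence, `ε, R → 0`, separation of finite measures by bounded Lipschitz functions
(`ext_of_forall_lipschitz_integral_eq`).

* `fullIdentification_of_productCellN_P` — the soft assembly under `P`;
* `stub_nestedTransferP` — the registered stub (r6 signature).
-/

noncomputable section

open scoped BigOperators Topology NNReal ENNReal Classical BoundedContinuousFunction
open Filter Set MeasureTheory Metric
open Literature.Probability.LatticeModels (HexVertex hexGraph hexCenter triZeta Site)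
open Literature.Probability.RandomPlanarGeometry
open Literature.Probability.RandomPlanarGeometry.SAW

namespace Summit.CriticalPhenomena.SAWScalingLimit.Theorems.ObservableToSLER.NestedGate

open Summit.CriticalPhenomena.SAWScalingLimit.Theorems.ObservableToSLER.BridgeGate
open Summit.CriticalPhenomena.SAWScalingLimit.Theorems.ObservableToSLE.Negative
  (eventually_isProbabilityMeasure_hexSAWLaw)

section Final

/-- **Full identification from the product-cell structure over tame nested families, under an
arbitrary family constraint `P`** (the soft assembly of the nested transfer, r6 shape):
`GateDecomposition`, the abundance input `NestedRenewalP P` (tame nested families SATISFYING `P`,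
widely linked first good gates with probability `≥ 1 − ε`), the identification input
`CarvedToSLENP P` (ASSUMING `P`) and the eventual product structure of the cells (for ALL tame
nested families) identify every probability subsequential limit law of the critical hexagonal SAW
as the chordal SLE(8/3) law.  Same proof as the r4 `fullIdentification_of_productCellN_link`, the
fact `hP : P D a b δ ρ R N S T` delivered by the abundance input being handed to the
identification input in place of the two anchoring facts. -/
theorem fullIdentification_of_productCellN_P
    (P : DobrushinDomain → (ℝ → HexVertex) → (ℝ → HexVertex) → ℝ → ℝ → ℝ → ℕ →
      (ℕ → Set HexVertex) → (ℕ → Set HexVertex) → Prop)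
    (hGD : ∀ (Ω : Set ℂ) (δ : ℝ) (a b p q p' q' : HexVertex) (S T : Set HexVertex)
       (l₁ l₂ : List HexVertex) (B : Set (List HexVertex)),
       Disjoint S T →
       (∃ w₁ : (hexDomainGraph Ω δ).Walk a p, w₁.IsPath ∧ w₁.support = l₁ ∧ ∀ v ∈ l₁, v ∈ S) →
       (∃ w₂ : (hexDomainGraph Ω δ).Walk p' b, w₂.IsPath ∧ w₂.support = l₂ ∧ ∀ v ∈ l₂, v ∈ T) →
       (hexDomainGraph Ω δ).Adj p q → (hexDomainGraph Ω δ).Adj q' p' →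
       hexSAWWeight Ω δ a b
           {γ | ∃ mid ∈ B, mid.head? = some q ∧ mid.getLast? = some q' ∧
             (∀ v ∈ mid, v ∉ S ∧ v ∉ T) ∧ γ.walk.support = l₁ ++ mid ++ l₂} =
         ENNReal.ofReal (hexCriticalFugacity ^ (l₁.length + l₂.length)) *
           hexSAWWeight Ω δ q q'
             {γ | γ.walk.support ∈ B ∧ ∀ v ∈ γ.walk.support, v ∉ S ∧ v ∉ T})
    (hNR : ∀ (D : DobrushinDomain) (a b : ℝ → HexVertex), IsEmbEndpointApprox hexGraph hexCenter D a b →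
       ∀ ε > (0 : ℝ), ∀ R > (0 : ℝ), ∃ ρ > (0 : ℝ), ∃ N : ℕ, ∀ᶠ δ : ℝ in 𝓝[>] 0,
         ∃ S T : ℕ → Set HexVertex,
           TameNestedFamily δ R N (a δ) S ∧ TameNestedFamily δ R N (b δ) T ∧
           P D a b δ ρ R N S T ∧
           hexSAWLaw D.carrier δ (a δ) (b δ)
               {γ | ¬ ∃ (n m : ℕ) (p q : HexVertex) (n' m' : ℕ) (p' q' : HexVertex),
                   IsFirstGoodGateN D.carrier δ ρ R S (a δ) γ.walk.support n m p q ∧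
                   IsFirstGoodGateN D.carrier δ ρ R T (b δ) γ.walk.support.reverse n' m' p' q' ∧
                   WideLink D.carrier δ ρ (S n ∪ T n') q q'} ≤
             ENNReal.ofReal ε)
    (hCN : ∀ (D : DobrushinDomain) (a b : ℝ → HexVertex), IsEmbEndpointApprox hexGraph hexCenter D a b →
       ∀ (ν : Measure (CurveClass ℂ)), IsSLELaw ((8 : ℝ≥0) / 3) D ν →
       ∀ (f : CurveClass ℂ →ᵇ ℝ) (ε : ℝ), 0 < ε →
         ∃ R₀ > (0 : ℝ), ∀ R ∈ Set.Ioc (0 : ℝ) R₀, ∀ ρ > (0 : ℝ), ∀ N : ℕ,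
           ∀ᶠ δ : ℝ in 𝓝[>] 0, ∀ S T : ℕ → Set HexVertex,
             TameNestedFamily δ R N (a δ) S → TameNestedFamily δ R N (b δ) T →
             P D a b δ ρ R N S T →
             hexSAWLaw D.carrier δ (a δ) (b δ)
               {γ | ∃ (n m : ℕ) (p q : HexVertex) (n' m' : ℕ) (p' q' : HexVertex),
                   IsFirstGoodGateN D.carrier δ ρ R S (a δ) γ.walk.support n m p q ∧
                   IsFirstGoodGateN D.carrier δ ρ R T (b δ) γ.walk.support.reverse n' m' p' q' ∧
                   WideLink D.carrier δ ρ (S n ∪ T n') q q' ∧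
                   ε < |(∫ ξ, f ξ.curve ∂(carvedLaw D.carrier δ (S n ∪ T n') q q')) - ∫ x, f x ∂ν|} ≤
               ENNReal.ofReal ε)
    (hcells : ∀ (D : DobrushinDomain) (a b : ℝ → HexVertex), IsEmbEndpointApprox hexGraph hexCenter D a b →
       ∃ R₁ > (0 : ℝ), ∀ R ∈ Set.Ioc (0 : ℝ) R₁, ∀ (ρ : ℝ) (N : ℕ), ∀ᶠ δ : ℝ in 𝓝[>] 0,
         ∀ S T : ℕ → Set HexVertex, TameNestedFamily δ R N (a δ) S →
           TameNestedFamily δ R N (b δ) T →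
           ∀ γ₀ : HexDomainSAW D.carrier δ (a δ) (b δ),
             γ₀ ∈ productCellN D.carrier δ ρ R S T (a δ) (b δ) (3 * R))
    (D : DobrushinDomain) (a b : ℝ → HexVertex) (hab : IsEmbEndpointApprox hexGraph hexCenter D a b)
    (μ : Measure (CurveClass ℂ)) (hμ : IsProbabilityMeasure μ)
    (hsub : IsSubseqLimitLaw (fun δ (γ : HexDomainSAW D.carrier δ (a δ) (b δ)) => γ.curve)
      (fun δ => hexSAWLaw D.carrier δ (a δ) (b δ)) μ) :
    IsSLELaw ((8 : ℝ≥0) / 3) D μ := by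
  obtain ⟨ν, hν⟩ := exists_isSLELaw_of_ne_eight (κ := (8 : ℝ≥0) / 3) (by positivity) (by norm_num) D
  obtain ⟨Γ, hΓ, rfl⟩ := hν
  haveI := isProbabilityMeasure_preWienerMeasure'
  haveI : IsProbabilityMeasure (Literature.Probability.Process.preWienerMeasure.map Γ) :=
    Measure.isProbabilityMeasure_map hΓ.1
  suffices hμν : μ = Literature.Probability.Process.preWienerMeasure.map Γ from ⟨Γ, hΓ, hμν⟩
  set ν := Literature.Probability.Process.preWienerMeasure.map Γ with hνdef
  have hνlaw : IsSLELaw ((8 : ℝ≥0) / 3) D ν := ⟨Γ, hΓ, rfl⟩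
  obtain ⟨s, hs, hlim⟩ := hsub
  refine ext_of_forall_lipschitz_integral_eq fun f K hf => ?_
  -- `|∫ f dμ - ∫ f dν| ≤ η` for every `η > 0`
  have key : ∀ η : ℝ, 0 < η → |∫ x, f x ∂μ - ∫ x, f x ∂ν| ≤ η := by
    intro η hη
    set ε : ℝ := η / (4 * (1 + 4 * ‖f‖)) with hε
    have hε0 : 0 < ε := by positivity
    obtain ⟨R₀, hR₀, hCN'⟩ := hCN D a b hab ν hνlaw f ε hε0
    obtain ⟨R₁, hR₁, hcells'⟩ := hcells D a b hab
    set R : ℝ := min (min R₀ R₁) (η / (2 * (3 * K + 1))) with hR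
    have hRpos : 0 < R := by positivity
    have hRR₀ : R ≤ R₀ := (min_le_left _ _).trans (min_le_left _ _)
    have hRR₁ : R ≤ R₁ := (min_le_left _ _).trans (min_le_right _ _)
    have hK : (0 : ℝ) ≤ K := K.2
    have hRη : (K : ℝ) * (3 * R) ≤ η / 2 := by
      have h1 : R ≤ η / (2 * (3 * K + 1)) := min_le_right _ _
      calc (K : ℝ) * (3 * R) = 3 * K * R := by ring
        _ ≤ (3 * K + 1) * R := by nlinarith
        _ ≤ (3 * K + 1) * (η / (2 * (3 * K + 1))) := mul_le_mul_of_nonneg_left h1 (by positivity)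
        _ = η / 2 := by field_simp
    have hεη : 2 * ε * (1 + 4 * ‖f‖) = η / 2 := by
      rw [hε]; field_simp; ring
    obtain ⟨ρ, hρ, N, hNR'⟩ := hNR D a b hab ε hε0 R hRpos
    have hCN'' := hCN' R ⟨hRpos, hRR₀⟩ ρ hρ N
    have hcells'' := hcells' R ⟨hRpos, hRR₁⟩ ρ N
    have hprob := eventually_isProbabilityMeasure_hexSAWLaw hab
    have hev : ∀ᶠ δ : ℝ in 𝓝[>] 0,
        |∫ γ, f γ.curve ∂(hexSAWLaw D.carrier δ (a δ) (b δ)) - ∫ x, f x ∂ν| ≤ η := by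
      filter_upwards [hNR', hCN'', hcells'', hprob, self_mem_nhdsWithin] with δ h1 h2 h3 h4 hδ
      haveI := h4
      obtain ⟨S, T, hS, hT, hP, h1⟩ := h1
      have hest := abs_integral_sub_le_of_productCellN_link (ρ := ρ) (R := R) (S := S) (T := T)
        D.isBounded hδ (by positivity : (0 : ℝ) ≤ 3 * R) (hGD D.carrier δ (a δ) (b δ))
        (h3 S T hS hT) ν f hf hε0.le (ENNReal.toReal_le_of_le_ofReal hε0.le h1)
        (ENNReal.toReal_le_of_le_ofReal hε0.le (h2 S T hS hT hP))
      calc _ ≤ K * (3 * R) + 2 * ε * (1 + 4 * ‖f‖) := hest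
        _ ≤ η / 2 + η / 2 := add_le_add hRη hεη.le
        _ = η := by ring
    have hev' : ∀ᶠ n in atTop, |∫ γ, f γ.curve ∂(hexSAWLaw D.carrier (s n) (a (s n)) (b (s n))) -
        ∫ x, f x ∂ν| ≤ η := hs.eventually hev
    have hcont : Tendsto (fun n => |∫ γ, f γ.curve ∂(hexSAWLaw D.carrier (s n) (a (s n)) (b (s n))) -
        ∫ x, f x ∂ν|) atTop (𝓝 |∫ x, f x ∂μ - ∫ x, f x ∂ν|) :=
      ((hlim f).sub tendsto_const_nhds).abs
    exact le_of_tendsto hcont hev'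
  have h0 : |∫ x, f x ∂μ - ∫ x, f x ∂ν| ≤ 0 :=
    le_of_forall_pos_le_add fun η hη => by rw [zero_add]; exact key η hη
  exact sub_eq_zero.1 (abs_eq_zero.1 (le_antisymm h0 (abs_nonneg _)))

end Final

/-- **STUB 6 of the line `bridge-gate-renewal` (reshape r6) — THE NESTED TRANSFER UNDER AN ARBITRARY
FAMILY CONSTRAINT `P`**: `∀ P, GateDecomposition → NestedRenewalP P → CarvedToSLENP P →
FullIdentification` — every probability subsequential limit law of the critical hexagonal SAW in a
Dobrushin domain is the chordal SLE(8/3) law, given the exact two-gate factorisation, abundance of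
widely linked first good gates in SOME `P`-constrained tame nested families, and identification of
the carved middle laws over ALL `P`-constrained tame nested families.  Proof: the eventual product
structure of the cells over all tame nested families (`eventually_productCellN`) feeds the soft
assembly `fullIdentification_of_productCellN_P`. -/
theorem stub_nestedTransferP :
    ∀ (P : DobrushinDomain → (ℝ → HexVertex) → (ℝ → HexVertex) → ℝ → ℝ → ℝ → ℕ →
      (ℕ → Set HexVertex) → (ℕ → Set HexVertex) → Prop),
    (∀ (Ω : Set ℂ) (δ : ℝ) (a b p q p' q' : HexVertex) (S T : Set HexVertex) (l₁ l₂ : List HexVertex)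
       (B : Set (List HexVertex)),
       Disjoint S T →
       (∃ w₁ : (hexDomainGraph Ω δ).Walk a p, w₁.IsPath ∧ w₁.support = l₁ ∧ ∀ v ∈ l₁, v ∈ S) →
       (∃ w₂ : (hexDomainGraph Ω δ).Walk p' b, w₂.IsPath ∧ w₂.support = l₂ ∧ ∀ v ∈ l₂, v ∈ T) →
       (hexDomainGraph Ω δ).Adj p q → (hexDomainGraph Ω δ).Adj q' p' →
       hexSAWWeight Ω δ a b
           {γ | ∃ mid ∈ B, mid.head? = some q ∧ mid.getLast? = some q' ∧
             (∀ v ∈ mid, v ∉ S ∧ v ∉ T) ∧ γ.walk.support = l₁ ++ mid ++ l₂} =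
         ENNReal.ofReal (hexCriticalFugacity ^ (l₁.length + l₂.length)) *
           hexSAWWeight Ω δ q q'
             {γ | γ.walk.support ∈ B ∧ ∀ v ∈ γ.walk.support, v ∉ S ∧ v ∉ T}) →
    (∀ (D : DobrushinDomain) (a b : ℝ → HexVertex), IsEmbEndpointApprox hexGraph hexCenter D a b →
       ∀ ε > (0 : ℝ), ∀ R > (0 : ℝ), ∃ ρ > (0 : ℝ), ∃ N : ℕ, ∀ᶠ δ : ℝ in 𝓝[>] 0,
         ∃ S T : ℕ → Set HexVertex,
           TameNestedFamily δ R N (a δ) S ∧ TameNestedFamily δ R N (b δ) T ∧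
           P D a b δ ρ R N S T ∧
           hexSAWLaw D.carrier δ (a δ) (b δ)
               {γ | ¬ ∃ (n m : ℕ) (p q : HexVertex) (n' m' : ℕ) (p' q' : HexVertex),
                   IsFirstGoodGateN D.carrier δ ρ R S (a δ) γ.walk.support n m p q ∧
                   IsFirstGoodGateN D.carrier δ ρ R T (b δ) γ.walk.support.reverse n' m' p' q' ∧
                   WideLink D.carrier δ ρ (S n ∪ T n') q q'} ≤
             ENNReal.ofReal ε) →
    (∀ (D : DobrushinDomain) (a b : ℝ → HexVertex), IsEmbEndpointApprox hexGraph hexCenter D a b →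
       ∀ (ν : Measure (CurveClass ℂ)), IsSLELaw ((8 : ℝ≥0) / 3) D ν →
       ∀ (f : CurveClass ℂ →ᵇ ℝ) (ε : ℝ), 0 < ε →
         ∃ R₀ > (0 : ℝ), ∀ R ∈ Set.Ioc (0 : ℝ) R₀, ∀ ρ > (0 : ℝ), ∀ N : ℕ,
           ∀ᶠ δ : ℝ in 𝓝[>] 0, ∀ S T : ℕ → Set HexVertex,
             TameNestedFamily δ R N (a δ) S → TameNestedFamily δ R N (b δ) T →
             P D a b δ ρ R N S T →
             hexSAWLaw D.carrier δ (a δ) (b δ)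
               {γ | ∃ (n m : ℕ) (p q : HexVertex) (n' m' : ℕ) (p' q' : HexVertex),
                   IsFirstGoodGateN D.carrier δ ρ R S (a δ) γ.walk.support n m p q ∧
                   IsFirstGoodGateN D.carrier δ ρ R T (b δ) γ.walk.support.reverse n' m' p' q' ∧
                   WideLink D.carrier δ ρ (S n ∪ T n') q q' ∧
                   ε < |(∫ ξ, f ξ.curve ∂(carvedLaw D.carrier δ (S n ∪ T n') q q')) - ∫ x, f x ∂ν|} ≤
               ENNReal.ofReal ε) →
    ∀ (D : DobrushinDomain) (a b : ℝ → HexVertex),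
      IsEmbEndpointApprox hexGraph hexCenter D a b →
      ∀ μ : Measure (CurveClass ℂ), IsProbabilityMeasure μ →
        IsSubseqLimitLaw (fun δ (γ : HexDomainSAW D.carrier δ (a δ) (b δ)) => γ.curve)
          (fun δ => hexSAWLaw D.carrier δ (a δ) (b δ)) μ →
        IsSLELaw ((8 : ℝ≥0) / 3) D μ :=
  fun P hGD hNR hCN D a b hab μ hμ hsub =>
    fullIdentification_of_productCellN_P P hGD hNR hCN
      (fun D a b hab => eventually_productCellN D a b hab) D a b hab μ hμ hsub

end Summit.CriticalPhenomena.SAWScalingLimit.Theorems.ObservableToSLER.NestedGate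

end
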